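import Literature.Probability.LatticeModels.UrsellInversion
import Mathlib.Algebra.BigOperators.Ring.Finset
import HarnessLib

/-!
# Ursell functions of partition-structured moments

Topic `Literature/Probability/LatticeModels`; a companion of `UrsellInversion.lean` (Möbius inversion
`ursellOf m` over set partitions, Ruelle 1969 §4.4.1 (4.5)–(4.7)).

The situation: the "moments" `M(P)` of a label set `P` are themselves superpositions over the set
partitions `σ` of `P` of weighted *block-family moments*,

  `M(P) = Σ_{σ ∈ setPartitions P} (Π_{B∈σ} w_B) · n(σ)`,

where `n` is a moment function on finite FAMILIES OF BLOCKS (`n : Finset (Finset α) → C`, `n ∅ = 1`)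
and `w_B` are block weights (zero weights switch block shapes off).  This is what the iterated
derivatives of a Gaussian expectation along a multi-affine interpolation look like: Bałaban–Imbrie–Jaffe
1988 §5.13 p. 305, where `∂/∂s_Γ` of `⟨H⟩_s` produces, before truncation, the moments of the
products `Π_{B∈σ} V_B` of block vertices over the partitions `σ` of `Γ` into blocks of one or two
cubes (`BIJ88PairingAllOrders5133`), and the print then passes to truncated expectations
`Σ_σ ⟨Π_{B∈σ}[V_B;]·⟩`.  THE THEOREM: truncation commutes with this superposition —

  `Mᵀ(V) = Σ_{σ ∈ setPartitions V} (Π_{B∈σ} w_B) · nᵀ(σ)`     (`V ≠ ∅`),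

the Ursell function of `M` at `V` is the same superposition of the Ursell functions `nᵀ = ursellOf n`
of the block-family moments, taken at the families `σ` (joint truncation of the block variables).

## Main results

* `eq_ursellOf_of_block` — the block form `Σ_{v∈P₀⊆V} u(P₀) m(V∖P₀) = m(V)` characterizes `u = mᵀ`;
* `sum_block_setPartitions_split` — marked decomposition: (`P₀ ∋ v`, a partition `τ` of `P₀`, a
  partition `κ` of `V ∖ P₀`) ↔ (a partition `σ = τ ∪ κ` of `V`, a sub-family `τ ⊆ σ` containing the
  block of `v`);
* **`ursellOf_sum_setPartitions`** — the theorem.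

Everything is proved; no definition, no named fact.  Filed from the lit-balaban cell (seat p13 gen 12) for
Bałaban–Imbrie–Jaffe 1988 §5.13:
statement-level skeleton of published theorems with citation tags; proofs where landed; nothing here is a claim
about the Yang–Mills mass gap

## Sources

D. Ruelle, *Statistical Mechanics: Rigorous Results* (1969), §4.4.1 (4.5)–(4.7) (`Ruelle1969`);
T. Bałaban, J. Imbrie, A. Jaffe, Commun. Math. Phys. 114 (1988) 257–315, §5.13 p. 305
(`BalabanImbrieJaffe1988`): the display *"⟨Πf(□_i)⟩_1 = Σ_Γ∫ds_Γ Σ_{pairings} ⟨Π_γ[⟨□Φ,Δ□Φ⟩;]Πf⟩"*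
is this regrouping applied to the `s`-derivatives (with the one-cube blocks restored, GAPS G-C2-24).

## Proof

By `eq_ursellOf_of_block` it suffices to check the block form for the candidate; expanding both
moments, the left side is a sum over (`P₀`, `τ`, `κ`), the right side — after the block form of `n`
at the block of `v` inside each `σ` (`sum_ursellOf_mul_eq`) and `Π_σ w = Π_τ w · Π_{σ∖τ} w` — a sum over
(`σ`, `τ`); `sum_block_setPartitions_split` matches them.
-/

open Finset

namespace Literature.Probability.LatticeModels

variable {α : Type*} [DecidableEq α] {C : Type*} [CommRing C]

/-- **The block form characterizes the Ursell function**: if `u` satisfies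
`Σ_{v ∈ P₀ ⊆ V} u(P₀) m(V ∖ P₀) = m(V)` for every `v ∈ V` (`m ∅ = 1`), then `u = mᵀ` on nonempty sets
(strong induction; Ruelle 1969 (4.6): `Γ` is invertible). [cite: Ruelle1969, §4.4.1 (4.6)-(4.7)] -/
theorem eq_ursellOf_of_block (m u : Finset α → C) (hm0 : m ∅ = 1)
    (hu : ∀ (V : Finset α) (v : α), v ∈ V →
      ∑ P₀ ∈ V.powerset.filter (fun P => v ∈ P), u P₀ * m (V \ P₀) = m V)
    {V : Finset α} (hV : V.Nonempty) : u V = ursellOf m V := by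
  induction V using Finset.strongInduction with
  | H V ih =>
    obtain ⟨v, hv⟩ := hV
    have hVF : V ∈ V.powerset.filter (fun P => v ∈ P) := mem_filter.2 ⟨mem_powerset.2 Subset.rfl, hv⟩
    have h1 := hu V v hv
    have h2 := sum_ursellOf_mul_eq m hm0 hv
    rw [← add_sum_erase _ _ hVF, Finset.sdiff_self, hm0, mul_one] at h1 h2
    have hs : ∑ P₀ ∈ (V.powerset.filter (fun P => v ∈ P)).erase V, u P₀ * m (V \ P₀)
        = ∑ P₀ ∈ (V.powerset.filter (fun P => v ∈ P)).erase V, ursellOf m P₀ * m (V \ P₀) := by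
      refine sum_congr rfl fun P₀ hP₀ => ?_
      obtain ⟨hne, hP₀⟩ := mem_erase.1 hP₀
      obtain ⟨hPV, hvP⟩ := mem_filter.1 hP₀
      rw [ih P₀ (Finset.ssubset_iff_subset_ne.2 ⟨mem_powerset.1 hPV, hne⟩) ⟨v, hvP⟩]
    linear_combination h1 - h2 - hs

/-- **Marked block decomposition.**  For `v ∈ V`: choosing a set `P₀ ∋ v`, a set partition `τ` of `P₀`
and a set partition `κ` of `V ∖ P₀` is the same as choosing a set partition `σ = τ ∪ κ` of `V` together
with a sub-family `τ ⊆ σ` containing the block of `v`. [cite: Ruelle1969, §4.4.1 (4.7)] -/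
theorem sum_block_setPartitions_split {M : Type*} [AddCommMonoid M] {V : Finset α} {v : α}
    (hv : v ∈ V) (F : Finset (Finset α) → Finset (Finset α) → M) :
    ∑ P₀ ∈ V.powerset.filter (fun P => v ∈ P), ∑ τ ∈ setPartitions P₀,
        ∑ κ ∈ setPartitions (V \ P₀), F τ κ
      = ∑ σ ∈ setPartitions V, ∑ τ ∈ σ.powerset.filter (fun τ => blockOf σ v ∈ τ), F τ (σ \ τ) := by
  simp_rw [← sum_product']
  rw [sum_sigma', sum_sigma']
  refine sum_nbij'
    (fun x => (⟨x.2.1 ∪ x.2.2, x.2.1⟩ : Σ _ : Finset (Finset α), Finset (Finset α)))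
    (fun y => (⟨y.2.biUnion id, (y.2, y.1 \ y.2)⟩ :
      Σ _ : Finset α, Finset (Finset α) × Finset (Finset α))) ?_ ?_ ?_ ?_ ?_
  · -- into
    rintro ⟨P₀, τ, κ⟩ hx
    simp only [mem_sigma, mem_filter, mem_powerset, mem_product, mem_setPartitions] at hx ⊢
    obtain ⟨⟨hP₀V, hvP₀⟩, hτ, hκ⟩ := hx
    have hVeq : P₀ ∪ V \ P₀ = V := union_sdiff_of_subset hP₀V
    have hσ : IsSetPartition V (τ ∪ κ) := by
      have h := hτ.union hκ disjoint_sdiff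
      rwa [hVeq] at h
    obtain ⟨B, hB, hvB⟩ := hτ.exists_mem hvP₀
    refine ⟨hσ, subset_union_left, ?_⟩
    rw [hσ.eq_blockOf (mem_union_left _ hB) hvB]
    exact hB
  · -- back
    rintro ⟨σ, τ⟩ hy
    simp only [mem_sigma, mem_filter, mem_powerset, mem_product, mem_setPartitions] at hy ⊢
    obtain ⟨hσ, hτσ, hbτ⟩ := hy
    refine ⟨⟨biUnion_subset.2 fun B hB => hσ.subset (hτσ hB),
      mem_biUnion.2 ⟨blockOf σ v, hbτ, hσ.mem_blockOf hv⟩⟩, hσ.of_subset hτσ, hσ.sdiff hτσ⟩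
  · -- left inverse
    rintro ⟨P₀, τ, κ⟩ hx
    simp only [mem_sigma, mem_filter, mem_powerset, mem_product, mem_setPartitions] at hx
    obtain ⟨⟨hP₀V, hvP₀⟩, hτ, hκ⟩ := hx
    have hdisj : Disjoint τ κ := hτ.disjoint_family hκ disjoint_sdiff
    simp only [hτ.biUnion_id, union_sdiff_cancel_left hdisj]
  · -- right inverse
    rintro ⟨σ, τ⟩ hy
    simp only [mem_sigma, mem_filter, mem_powerset] at hy
    simp only [union_sdiff_of_subset hy.2.1]
  · -- summands
    rintro ⟨P₀, τ, κ⟩ hx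
    simp only [mem_sigma, mem_filter, mem_powerset, mem_product, mem_setPartitions] at hx
    have hdisj : Disjoint τ κ := hx.2.1.disjoint_family hx.2.2 disjoint_sdiff
    simp only [union_sdiff_cancel_left hdisj]

/-- **Ursell functions of partition-structured moments.**  If
`M(P) = Σ_{σ ∈ setPartitions P} (Π_{B∈σ} w_B) n(σ)` with `n ∅ = 1`, then for every nonempty `V`

  `Mᵀ(V) = Σ_{σ ∈ setPartitions V} (Π_{B∈σ} w_B) nᵀ(σ)`

— truncation commutes with the superposition over block structures: the truncated function of the
compound moments is the same superposition of the JOINT truncations `nᵀ(σ) = ursellOf n σ` of the block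
variables (the combinatorial identity by which Bałaban–Imbrie–Jaffe write the `s_Γ`-derivative of a
normalized Gaussian expectation as *"Σ over pairings of ⟨Π_γ[⟨□_{i_γ}Φ,Δ□_{j_γ}Φ⟩;]Πf⟩"*, p. 305; with
all blocks of size ≤ 2 it is the corrected form of that display). [cite: BalabanImbrieJaffe1988, §5.13 p.305] -/
theorem ursellOf_sum_setPartitions (w : Finset α → C) (n : Finset (Finset α) → C) (hn : n ∅ = 1)
    {V : Finset α} (hV : V.Nonempty) :
    ursellOf (fun P => ∑ σ ∈ setPartitions P, (∏ B ∈ σ, w B) * n σ) V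
      = ∑ σ ∈ setPartitions V, (∏ B ∈ σ, w B) * ursellOf n σ := by
  symm
  refine eq_ursellOf_of_block (fun P => ∑ σ ∈ setPartitions P, (∏ B ∈ σ, w B) * n σ)
    (fun P => ∑ σ ∈ setPartitions P, (∏ B ∈ σ, w B) * ursellOf n σ) ?_ ?_ hV
  · simp [setPartitions_empty, hn]
  · intro V v hv
    simp_rw [sum_mul_sum]
    rw [sum_block_setPartitions_split hv
      (fun τ κ => (∏ B ∈ τ, w B) * ursellOf n τ * ((∏ B ∈ κ, w B) * n κ))]
    refine sum_congr rfl fun σ hσ => ?_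
    have hb : blockOf σ v ∈ σ := (mem_setPartitions.1 hσ).blockOf_mem hv
    rw [← sum_ursellOf_mul_eq n hn hb, mul_sum]
    refine sum_congr rfl fun τ hτ => ?_
    have hτσ : τ ⊆ σ := mem_powerset.1 (mem_filter.1 hτ).1
    rw [← prod_sdiff hτσ]
    ring

end Literature.Probability.LatticeModels
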